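import Summits.AtomisticToContinuum.HydrodynamicLimit.Theorems.AntiMazurCoboundariesCorrectorPressureDecayKiferTangent
import Literature.Analysis.FunctionSpaces.PointConfigVagueTopology
import Literature.Analysis.FluidPDE.HardSphereTorusMeasure
import Mathlib.MeasureTheory.Measure.Haar.Unique
import Mathlib.Topology.UrysohnsLemma

/-!
# Bias continuity along tangent states, II: velocity-cutoff bookkeeping at finite `N`, cube volumes, cutoffs

Helper file 2/5 of crux stmt-AtomisticToContinuum-14135 `AntiMazurCoboundaries.CorrectorPressureDecay`, line `FirstLemma` (idea `kifer-compactification`), registered stub `stub_tangentBias : TangentBias`;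
namespace `…Theorems.KiferCompactification` (wave-2 stub-worker B of lead a1, split by the lead). Contents: the
finite-`N` velocity-cutoff bookkeeping `abs_integral_oneBody_sub_cutoff_le` (replacing `g̃` by `χ·g̃` and `1` by `∫ψ`
costs `κ·((N+1)(1 − ∫ψ) + E_Q[#{i : R < ‖vᵢ‖}])`); the volumes of the unit cube, its inner cube and its boundary
shell (`volume_unitCube_three`, `volume_innerCube`, `volume_real_shell_le`); and the two Urysohn cutoffs — a
continuous compactly supported `ψ`, `0 ≤ ψ ≤ 1`, equal to `1` on the inner cube `[δ₀, 1 − δ₀]³` and supported in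
the unit cube (`exists_position_cutoff`, registered as `stub_exists_position_cutoff`), and a velocity cutoff
`χ ∈ C_c`, `0 ≤ χ ≤ 1`, `χ = 1` on the ball of radius `R` (`exists_velocity_cutoff`).
-/


noncomputable section

open MeasureTheory ProbabilityTheory Set Filter Topology
open scoped ENNReal

namespace Summit.AtomisticToContinuum.HydrodynamicLimit.Theorems.KiferCompactification

open Literature.MathematicalPhysics.KineticTheory (T3 V3 hsDiameter localGibbsLaw blowUpPoint hsDiameter_pos
  succ_mul_hsDiameter_pow_three localGibbsLaw_eq localGibbsMeasure localGibbsMeasure_univ posPartition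
  posPartition_nonneg lintegral_localGibbsMeasure lintegral_posWeight_eq_one velMeasure zipConfig zipConfig_apply
  gaussMeasure lintegral_fintype_prod_eq_prod' canonicalPartition_eq_posPartition)
open Literature.MathematicalPhysics.KineticTheory.PointProcess (laplaceFunctional)
open Literature.Analysis.FluidPDE (HardSphereFlow Config windowSumReal particlesIn particlesIn_eq mem_particlesIn_iff)
open Literature.Analysis.FluidPDE.Torus (reprSym symCube measurable_reprSym map_reprSym_volume proj_reprSym
  closedBall_subset_symCube)
open Literature.Analysis.FunctionSpaces (PointConfig)
open Literature.Analysis.FunctionSpaces.Torus (proj unitCube continuous_proj measurableSet_unitCube mem_unitCube)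

/-- Bounded measurable functions on a finite measure space are integrable (real-valued, `|f| ≤ C`). -/
private theorem integrable_of_abs_le' {α : Type*} [MeasurableSpace α] {μ : Measure α} [IsFiniteMeasure μ]
    {f : α → ℝ} (hfm : Measurable f) {C : ℝ} (hfC : ∀ x, |f x| ≤ C) : Integrable f μ :=
  Integrable.of_bound hfm.aestronglyMeasurable C (ae_of_all _ fun x => by rw [Real.norm_eq_abs]; exact hfC x)

/-- Coordinates of labelled configurations are measurable: the position of particle `i`. -/
private theorem measurable_pos' {n : ℕ} (i : Fin n) : Measurable fun z : Config n (Fin 3) T3 => (z i).1 :=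
  (measurable_pi_apply i).fst

/-- Coordinates of labelled configurations are measurable: the velocity of particle `i`. -/
private theorem measurable_vel' {n : ℕ} (i : Fin n) : Measurable fun z : Config n (Fin 3) T3 => (z i).2 :=
  (measurable_pi_apply i).snd

/-! ## Finite-`N` velocity cutoff bookkeeping -/

/-- **Velocity cutoff at finite `N`.** For a probability law `Q`, a weight `0 ≤ φ ≤ 1`, a one-body observable
`|g̃| ≤ κ`, a continuous cutoff `0 ≤ χ ≤ 1` equal to `1` on the ball of radius `R`, and a mass defect `a ∈ [0, 1]`:
`|E_Q[Σᵢ φ(qᵢ) g̃(vᵢ)] − a E_Q[Σᵢ φ(qᵢ) χ(vᵢ) g̃(vᵢ)]| ≤ κ (n (1 − a) + E_Q[#{i : R < ‖vᵢ‖}])`. -/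
theorem abs_integral_oneBody_sub_cutoff_le {n : ℕ} (Q : Measure (Config n (Fin 3) T3)) [IsProbabilityMeasure Q]
    {φ : T3 → ℝ} (hφ : Continuous φ) (hφ0 : ∀ x, 0 ≤ φ x) (hφ1 : ∀ x, φ x ≤ 1)
    {gt : V3 → ℝ} (hgt : Continuous gt) {κ : ℝ} (hgtκ : ∀ v, |gt v| ≤ κ)
    {χ : V3 → ℝ} (hχ : Continuous χ) (hχ0 : ∀ v, 0 ≤ χ v) (hχ1 : ∀ v, χ v ≤ 1) {R : ℝ}
    (hχR : ∀ v, ‖v‖ ≤ R → χ v = 1) {a : ℝ} (ha0 : 0 ≤ a) (ha1 : a ≤ 1) :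
    |(∫ z, (∑ i, φ (z i).1 * gt (z i).2) ∂Q) - a * ∫ z, (∑ i, φ (z i).1 * (χ (z i).2 * gt (z i).2)) ∂Q| ≤
      κ * (n * (1 - a) + ∫ z, (∑ i, ({v : V3 | R < ‖v‖}).indicator (fun _ => (1 : ℝ)) (z i).2) ∂Q) := by
  have hκ0 : 0 ≤ κ := (abs_nonneg _).trans (hgtκ 0)
  have hmS : MeasurableSet {v : V3 | R < ‖v‖} := measurableSet_lt measurable_const continuous_norm.measurable
  -- integrability of the three bounded sums
  have hI1 : Integrable (fun z : Config n (Fin 3) T3 => ∑ i, φ (z i).1 * gt (z i).2) Q := by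
    refine integrable_of_abs_le' (Finset.measurable_sum _ fun i _ =>
      (hφ.measurable.comp (measurable_pos' i)).mul (hgt.measurable.comp (measurable_vel' i))) (C := n * κ) fun z => ?_
    calc |∑ i, φ (z i).1 * gt (z i).2| ≤ ∑ i, |φ (z i).1 * gt (z i).2| := Finset.abs_sum_le_sum_abs _ _
      _ ≤ ∑ _i : Fin n, κ := Finset.sum_le_sum fun i _ => by
          rw [abs_mul, abs_of_nonneg (hφ0 _)]
          exact (mul_le_mul (hφ1 _) (hgtκ _) (abs_nonneg _) zero_le_one).trans_eq (one_mul κ)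
      _ = n * κ := by simp
  have hI2 : Integrable (fun z : Config n (Fin 3) T3 => a * ∑ i, φ (z i).1 * (χ (z i).2 * gt (z i).2)) Q := by
    refine (integrable_of_abs_le' (Finset.measurable_sum _ fun i _ =>
      (hφ.measurable.comp (measurable_pos' i)).mul ((hχ.measurable.comp (measurable_vel' i)).mul
        (hgt.measurable.comp (measurable_vel' i)))) (C := n * κ) fun z => ?_).const_mul a
    calc |∑ i, φ (z i).1 * (χ (z i).2 * gt (z i).2)| ≤ ∑ i, |φ (z i).1 * (χ (z i).2 * gt (z i).2)| :=
          Finset.abs_sum_le_sum_abs _ _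
      _ ≤ ∑ _i : Fin n, κ := Finset.sum_le_sum fun i _ => by
          rw [abs_mul, abs_mul, abs_of_nonneg (hφ0 _), abs_of_nonneg (hχ0 _)]
          calc φ (z i).1 * (χ (z i).2 * |gt (z i).2|) ≤ 1 * (1 * κ) :=
                mul_le_mul (hφ1 _) (mul_le_mul (hχ1 _) (hgtκ _) (abs_nonneg _) zero_le_one)
                  (mul_nonneg (hχ0 _) (abs_nonneg _)) zero_le_one
            _ = κ := by ring
      _ = n * κ := by simp
  have hI3 : Integrable (fun z : Config n (Fin 3) T3 =>
      ∑ i, ({v : V3 | R < ‖v‖}).indicator (fun _ => (1 : ℝ)) (z i).2) Q := by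
    refine integrable_of_abs_le' (Finset.measurable_sum _ fun i _ =>
      (measurable_const.indicator hmS).comp (measurable_vel' i)) (C := n * 1) fun z => ?_
    calc |∑ i, ({v : V3 | R < ‖v‖}).indicator (fun _ => (1 : ℝ)) (z i).2|
        ≤ ∑ i, |({v : V3 | R < ‖v‖}).indicator (fun _ => (1 : ℝ)) (z i).2| := Finset.abs_sum_le_sum_abs _ _
      _ ≤ ∑ _i : Fin n, (1 : ℝ) := Finset.sum_le_sum fun i _ => by
          rw [abs_of_nonneg (Set.indicator_nonneg (fun _ _ => zero_le_one) _)]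
          exact Set.indicator_le_self' (fun _ _ => zero_le_one) _
      _ = n * 1 := by simp
  -- pointwise bound
  have hpt : ∀ z : Config n (Fin 3) T3,
      ‖(∑ i, φ (z i).1 * gt (z i).2) - a * ∑ i, φ (z i).1 * (χ (z i).2 * gt (z i).2)‖ ≤
        κ * (n * (1 - a)) + κ * ∑ i, ({v : V3 | R < ‖v‖}).indicator (fun _ => (1 : ℝ)) (z i).2 := by
    intro z
    rw [Real.norm_eq_abs, Finset.mul_sum, ← Finset.sum_sub_distrib]
    have hterm : ∀ i : Fin n, |φ (z i).1 * gt (z i).2 - a * (φ (z i).1 * (χ (z i).2 * gt (z i).2))| ≤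
        κ * (1 - a) + κ * ({v : V3 | R < ‖v‖}).indicator (fun _ => (1 : ℝ)) (z i).2 := by
      intro i
      have hfac : φ (z i).1 * gt (z i).2 - a * (φ (z i).1 * (χ (z i).2 * gt (z i).2)) =
          (φ (z i).1 * gt (z i).2) * (1 - a * χ (z i).2) := by ring
      have h1a : 0 ≤ 1 - a * χ (z i).2 := by nlinarith [hχ1 (z i).2, hχ0 (z i).2]
      have hcut : 1 - a * χ (z i).2 ≤ (1 - a) + ({v : V3 | R < ‖v‖}).indicator (fun _ => (1 : ℝ)) (z i).2 := by
        by_cases hv : R < ‖(z i).2‖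
        · rw [Set.indicator_of_mem (show (z i).2 ∈ {v : V3 | R < ‖v‖} from hv)]
          nlinarith [hχ0 (z i).2]
        · rw [hχR _ (not_lt.1 hv), Set.indicator_of_notMem (show (z i).2 ∉ {v : V3 | R < ‖v‖} from hv)]
          linarith
      rw [hfac, abs_mul, abs_of_nonneg h1a, abs_mul, abs_of_nonneg (hφ0 _)]
      calc φ (z i).1 * |gt (z i).2| * (1 - a * χ (z i).2) ≤ 1 * κ * (1 - a * χ (z i).2) := by
            gcongr
            · exact hφ1 _
            · exact hgtκ _
        _ ≤ 1 * κ * ((1 - a) + ({v : V3 | R < ‖v‖}).indicator (fun _ => (1 : ℝ)) (z i).2) := by gcongr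
        _ = κ * (1 - a) + κ * ({v : V3 | R < ‖v‖}).indicator (fun _ => (1 : ℝ)) (z i).2 := by ring
    calc |∑ i, (φ (z i).1 * gt (z i).2 - a * (φ (z i).1 * (χ (z i).2 * gt (z i).2)))|
        ≤ ∑ i, |φ (z i).1 * gt (z i).2 - a * (φ (z i).1 * (χ (z i).2 * gt (z i).2))| :=
          Finset.abs_sum_le_sum_abs _ _
      _ ≤ ∑ i, (κ * (1 - a) + κ * ({v : V3 | R < ‖v‖}).indicator (fun _ => (1 : ℝ)) (z i).2) :=
          Finset.sum_le_sum fun i _ => hterm i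
      _ = κ * (n * (1 - a)) + κ * ∑ i, ({v : V3 | R < ‖v‖}).indicator (fun _ => (1 : ℝ)) (z i).2 := by
          rw [Finset.sum_add_distrib, Finset.mul_sum]
          simp only [Finset.sum_const, Finset.card_univ, Fintype.card_fin, nsmul_eq_mul]
          ring
  rw [← integral_const_mul, ← integral_sub hI1 hI2, ← Real.norm_eq_abs]
  refine (norm_integral_le_of_norm_le
    (g := fun z : Config n (Fin 3) T3 => κ * (n * (1 - a)) + κ * ∑ i, ({v : V3 | R < ‖v‖}).indicator
      (fun _ => (1 : ℝ)) (z i).2) ((integrable_const _).add (hI3.const_mul κ)) (ae_of_all _ hpt)).trans ?_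
  rw [integral_add (f := fun _ : Config n (Fin 3) T3 => κ * (n * (1 - a)))
    (g := fun z : Config n (Fin 3) T3 => κ * ∑ i, ({v : V3 | R < ‖v‖}).indicator (fun _ => (1 : ℝ)) (z i).2)
    (integrable_const _) (hI3.const_mul κ), integral_const, probReal_univ, one_smul, integral_const_mul, mul_add]

/-! ## Volumes of cubes and the cutoffs -/

/-- The unit cube `[0,1)³` has Lebesgue measure `1` (transport along `WithLp.ofLp`). -/
-- adapted from `Literature/Analysis/FluidPDE/PalmLocalStateProofs.lean` (`volume_torusUnitCube`)
theorem volume_unitCube_three : volume (unitCube (Fin 3)) = 1 := by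
  have hpre : unitCube (Fin 3) = (@WithLp.ofLp 2 (Fin 3 → ℝ)) ⁻¹' Set.pi univ fun _ : Fin 3 => Ico (0 : ℝ) 1 := by
    ext y
    simp [mem_unitCube]
  rw [hpre, (PiLp.volume_preserving_ofLp (Fin 3)).measure_preimage
    (MeasurableSet.univ_pi fun _ => measurableSet_Ico).nullMeasurableSet, volume_pi_pi]
  simp

/-- The inner cube `[δ₀, 1 − δ₀]³` has Lebesgue measure `(1 − 2δ₀)³` (`δ₀ ≤ 1/2`). -/
theorem volume_innerCube {δ₀ : ℝ} (hδ₀ : δ₀ ≤ 1 / 2) :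
    volume {y : V3 | ∀ i, y i ∈ Icc δ₀ (1 - δ₀)} = ENNReal.ofReal ((1 - 2 * δ₀) ^ 3) := by
  have hpre : {y : V3 | ∀ i, y i ∈ Icc δ₀ (1 - δ₀)} =
      (@WithLp.ofLp 2 (Fin 3 → ℝ)) ⁻¹' Set.pi univ fun _ : Fin 3 => Icc δ₀ (1 - δ₀) := by
    ext y
    simp only [Set.mem_setOf_eq, Set.mem_preimage, Set.mem_univ_pi]
  rw [hpre, (PiLp.volume_preserving_ofLp (Fin 3)).measure_preimage
    (MeasurableSet.univ_pi fun _ => measurableSet_Icc).nullMeasurableSet, volume_pi_pi]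
  simp only [Real.volume_Icc, Finset.prod_const, Finset.card_univ, Fintype.card_fin]
  rw [← ENNReal.ofReal_pow (by linarith)]
  congr 1
  ring

/-- The inner cube is measurable. -/
theorem measurableSet_innerCube (δ₀ : ℝ) : MeasurableSet {y : V3 | ∀ i, y i ∈ Icc δ₀ (1 - δ₀)} := by
  have h : {y : V3 | ∀ i, y i ∈ Icc δ₀ (1 - δ₀)} = ⋂ i, (fun y : V3 => y i) ⁻¹' Icc δ₀ (1 - δ₀) := by
    ext y; simp
  rw [h]
  exact MeasurableSet.iInter fun i => measurableSet_Icc.preimage (PiLp.continuous_apply 2 _ i).measurable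

/-- The inner cube is closed. -/
theorem isClosed_innerCube (δ₀ : ℝ) : IsClosed {y : V3 | ∀ i, y i ∈ Icc δ₀ (1 - δ₀)} := by
  have h : {y : V3 | ∀ i, y i ∈ Icc δ₀ (1 - δ₀)} = ⋂ i, (fun y : V3 => y i) ⁻¹' Icc δ₀ (1 - δ₀) := by
    ext y; simp
  rw [h]
  exact isClosed_iInter fun i => isClosed_Icc.preimage (PiLp.continuous_apply 2 _ i)

/-- **The shell** `[0,1)³ ∖ [δ₀, 1 − δ₀]³` is measurable and has volume at most `6 δ₀` (`0 < δ₀ ≤ 1/2`). -/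
theorem volume_real_shell_le {δ₀ : ℝ} (hδ₀ : 0 < δ₀) (hδ₀' : δ₀ ≤ 1 / 2) :
    MeasurableSet (unitCube (Fin 3) \ {y : V3 | ∀ i, y i ∈ Icc δ₀ (1 - δ₀)}) ∧
      volume.real (unitCube (Fin 3) \ {y : V3 | ∀ i, y i ∈ Icc δ₀ (1 - δ₀)}) ≤ 6 * δ₀ := by
  refine ⟨measurableSet_unitCube.diff (measurableSet_innerCube δ₀), ?_⟩
  have hsub : {y : V3 | ∀ i, y i ∈ Icc δ₀ (1 - δ₀)} ⊆ unitCube (Fin 3) := fun y hy => by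
    rw [mem_unitCube]
    intro i
    exact ⟨hδ₀.le.trans (hy i).1, (hy i).2.trans_lt (by linarith)⟩
  have h2δ : 0 ≤ 1 - 2 * δ₀ := by linarith
  have hle1 : ENNReal.ofReal ((1 - 2 * δ₀) ^ 3) ≤ 1 := by
    rw [← ENNReal.ofReal_one]
    exact ENNReal.ofReal_le_ofReal (pow_le_one₀ h2δ (by linarith))
  rw [measureReal_def, measure_sdiff hsub (measurableSet_innerCube δ₀).nullMeasurableSet
    (by rw [volume_innerCube hδ₀']; exact ENNReal.ofReal_ne_top), volume_unitCube_three, volume_innerCube hδ₀',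
    ENNReal.toReal_sub_of_le hle1 ENNReal.one_ne_top, ENNReal.toReal_one, ENNReal.toReal_ofReal (pow_nonneg h2δ 3)]
  have hexp : (1 - 2 * δ₀) ^ 3 = 1 - 6 * δ₀ + (2 * δ₀) ^ 2 * (3 - 2 * δ₀) := by ring
  have hnn : 0 ≤ (2 * δ₀) ^ 2 * (3 - 2 * δ₀) := mul_nonneg (sq_nonneg _) (by linarith)
  linarith

/-- **Position cutoff.** For `0 < δ₀ ≤ 1/2` there is a continuous `ψ : ℝ³ → [0, 1]`, supported inside the unit cube
`[0,1)³`, equal to `1` on the inner cube `[δ₀, 1 − δ₀]³`, with `(1 − 2δ₀)³ ≤ ∫ψ ≤ 1` (Urysohn between the compact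
inner cube and the open cube). -/
theorem exists_position_cutoff {δ₀ : ℝ} (hδ₀ : 0 < δ₀) (hδ₀' : δ₀ ≤ 1 / 2) :
    ∃ ψ : V3 → ℝ, Continuous ψ ∧ HasCompactSupport ψ ∧ (∀ y, 0 ≤ ψ y) ∧ (∀ y, ψ y ≤ 1) ∧
      Function.support ψ ⊆ unitCube (Fin 3) ∧ (∀ y : V3, (∀ i, y i ∈ Icc δ₀ (1 - δ₀)) → ψ y = 1) ∧
      (1 - 2 * δ₀) ^ 3 ≤ ∫ y, ψ y ∧ ∫ y, ψ y ≤ 1 := by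
  -- the open cube
  set O : Set V3 := {y | ∀ i, y i ∈ Ioo (0 : ℝ) 1} with hO
  have hOeq : O = ⋂ i, (fun y : V3 => y i) ⁻¹' Ioo (0 : ℝ) 1 := by ext y; simp [hO]
  have hOopen : IsOpen O := by
    rw [hOeq]
    exact isOpen_iInter_of_finite fun i => isOpen_Ioo.preimage (PiLp.continuous_apply 2 _ i)
  have hOcube : O ⊆ unitCube (Fin 3) := fun y hy => by
    rw [mem_unitCube]
    exact fun i => ⟨(hy i).1.le, (hy i).2⟩
  have hcube_bdd : Bornology.IsBounded (unitCube (Fin 3)) := by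
    rw [Metric.isBounded_iff_subset_closedBall 0]
    refine ⟨Real.sqrt 3, fun y hy => ?_⟩
    rw [mem_unitCube] at hy
    rw [Metric.mem_closedBall, dist_zero_right, EuclideanSpace.norm_eq]
    refine Real.sqrt_le_sqrt ?_
    calc ∑ i, ‖y i‖ ^ 2 ≤ ∑ _i : Fin 3, (1 : ℝ) := Finset.sum_le_sum fun i _ => by
          rw [Real.norm_eq_abs, sq_le_one_iff_abs_le_one, abs_abs, abs_le]
          exact ⟨by linarith [(hy i).1], (hy i).2.le⟩
      _ = 3 := by simp
  have hOcomp : IsCompact (closure O) := (hcube_bdd.subset hOcube).isCompact_closure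
  have hinner_sub : {y : V3 | ∀ i, y i ∈ Icc δ₀ (1 - δ₀)} ⊆ O := fun y hy i =>
    ⟨hδ₀.trans_le (hy i).1, (hy i).2.trans_lt (by linarith)⟩
  obtain ⟨f, hfO, hf1, hf01⟩ := exists_tsupport_one_of_isOpen_isClosed hOopen hOcomp (isClosed_innerCube δ₀)
    hinner_sub
  have hsupp : Function.support f ⊆ unitCube (Fin 3) := (subset_tsupport _).trans (hfO.trans hOcube)
  have hcs : HasCompactSupport f :=
    hOcomp.of_isClosed_subset (isClosed_tsupport _) (hfO.trans subset_closure)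
  have hint : Integrable f := f.continuous.integrable_of_hasCompactSupport hcs
  refine ⟨f, f.continuous, hcs, fun y => (hf01 y).1, fun y => (hf01 y).2, hsupp, fun y hy => hf1 hy, ?_, ?_⟩
  · -- lower bound: `f ≥ 1` on the inner cube
    have hle : ∀ y, ({y : V3 | ∀ i, y i ∈ Icc δ₀ (1 - δ₀)}).indicator (fun _ => (1 : ℝ)) y ≤ f y := by
      intro y
      by_cases hy : y ∈ {y : V3 | ∀ i, y i ∈ Icc δ₀ (1 - δ₀)}
      · rw [Set.indicator_of_mem hy, hf1 hy]
        simp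
      · rw [Set.indicator_of_notMem hy]
        exact (hf01 y).1
    calc (1 - 2 * δ₀) ^ 3 = ∫ y, ({y : V3 | ∀ i, y i ∈ Icc δ₀ (1 - δ₀)}).indicator (fun _ => (1 : ℝ)) y := by
          rw [integral_indicator_const _ (measurableSet_innerCube δ₀), smul_eq_mul, mul_one, measureReal_def,
            volume_innerCube hδ₀', ENNReal.toReal_ofReal (pow_nonneg (by linarith) 3)]
      _ ≤ ∫ y, f y := integral_mono ((integrable_indicator_iff (measurableSet_innerCube δ₀)).2
          (integrableOn_const (by rw [volume_innerCube hδ₀']; exact ENNReal.ofReal_ne_top))) hint hle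
  · -- upper bound: `f ≤ 1_{cube}`
    have hle : ∀ y, f y ≤ (unitCube (Fin 3)).indicator (fun _ => (1 : ℝ)) y := by
      intro y
      by_cases hy : y ∈ unitCube (Fin 3)
      · rw [Set.indicator_of_mem hy]
        exact (hf01 y).2
      · rw [Set.indicator_of_notMem hy]
        exact (Function.notMem_support.1 fun h => hy (hsupp h)).le
    calc ∫ y, f y ≤ ∫ y, (unitCube (Fin 3)).indicator (fun _ => (1 : ℝ)) y :=
          integral_mono hint ((integrable_indicator_iff measurableSet_unitCube).2
            (integrableOn_const (by rw [volume_unitCube_three]; exact ENNReal.one_ne_top))) hle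
      _ = 1 := by
          rw [integral_indicator_const _ measurableSet_unitCube, smul_eq_mul, mul_one, measureReal_def,
            volume_unitCube_three, ENNReal.toReal_one]

/-- **Velocity cutoff.** A continuous compactly supported `χ : ℝ³ → [0, 1]` equal to `1` on the closed ball of
radius `R` (Urysohn). -/
theorem exists_velocity_cutoff (R : ℝ) :
    ∃ χ : V3 → ℝ, Continuous χ ∧ HasCompactSupport χ ∧ (∀ v, 0 ≤ χ v) ∧ (∀ v, χ v ≤ 1) ∧
      ∀ v, ‖v‖ ≤ R → χ v = 1 := by
  obtain ⟨f, hfO, hf1, hf01⟩ := exists_tsupport_one_of_isOpen_isClosed (Metric.isOpen_ball (x := (0 : V3))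
    (ε := R + 1)) Metric.isBounded_ball.isCompact_closure Metric.isClosed_closedBall
    (Metric.closedBall_subset_ball (by linarith : R < R + 1))
  refine ⟨f, f.continuous, ?_, fun v => (hf01 v).1, fun v => (hf01 v).2, fun v hv => hf1 ?_⟩
  · exact Metric.isBounded_ball.isCompact_closure.of_isClosed_subset (isClosed_tsupport _)
      (hfO.trans subset_closure)
  · rwa [Metric.mem_closedBall, dist_zero_right]

/-- Registered stub `stub_exists_position_cutoff` (line `FirstLemma`, helper of `stub_tangentBias`): the position
cutoff (= `exists_position_cutoff`). -/
theorem stub_exists_position_cutoff {δ₀ : ℝ} (hδ₀ : 0 < δ₀) (hδ₀' : δ₀ ≤ 1 / 2) :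
    ∃ ψ : V3 → ℝ, Continuous ψ ∧ HasCompactSupport ψ ∧ (∀ y, 0 ≤ ψ y) ∧ (∀ y, ψ y ≤ 1) ∧
      Function.support ψ ⊆ unitCube (Fin 3) ∧ (∀ y : V3, (∀ i, y i ∈ Icc δ₀ (1 - δ₀)) → ψ y = 1) ∧
      (1 - 2 * δ₀) ^ 3 ≤ ∫ y, ψ y ∧ ∫ y, ψ y ≤ 1 :=
  exists_position_cutoff hδ₀ hδ₀'

end Summit.AtomisticToContinuum.HydrodynamicLimit.Theorems.KiferCompactification
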